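/-
Copyright (c) 2026. All rights reserved.
Released under Apache 2.0 license as described in the file LICENSE.
Authors: HodgeCM publication cell (pub-hodgecm), GR lane, seat GR-2 (`pub-hodgecm-own-hyp34`).
-/
import Literature.NumberTheory.Weil1964.AdelicMetaplecticUnitaryLeg
import Literature.NumberTheory.Automorphic.AdelicPiSchwartzBruhatPlancherel
import Literature.RepresentationTheory.HeisenbergGroup.SchrodingerL2Haar
import HarnessLib

/-!
# The unitary leg of `Mp_ψ(W_𝐀)ᶜᵒⁿᵗ` on `L²(𝐀_F^ι)` — the instance of record of `AdelicMetaplecticUnitaryLeg`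

Topic `NumberTheory/Weil1964`; namespace `Literature.NumberTheory.Weil1964`.  KERNEL ONLY: definitions with bodies
(`schwartzBruhatToL2`, `adelicMpCont.unitaryLegL2`) and proved theorems; nothing of [Weil1964] or [GelbartRogawski1991]
asserted.

[GelbartRogawski1991, §3.1 p. 454 L19–27]: `ρ_ψ` is "an irreducible unitary representation of `H_𝐀(W)`" on a Hilbert
space and `Mp_𝐀(W)` the pairs `(g, M_g)` of bounded operators on it; [Weil1964, Chap. I n° 11–13]: the smooth model on
`𝒮(X_A)` sits inside `L²(X_A)` and the metaplectic operators are (multiples of) unitary operators.  The abstract file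
`AdelicMetaplecticUnitaryLeg` turns the smooth group of record `adelicMpCont F ι T` into unitary pairs on ANY completion
`i : 𝒮(𝐀_F^ι) →ₗ H`; here `H = L²(𝐀_F^ι, ν)` for an additive Haar measure `ν` and `i` is the class map:

* §1 **`schwartzBruhatToL2 F ι ν : 𝒮(𝐀_F^ι) →ₗ[ℂ] L²(𝐀_F^ι, ν)`** (`Φ ↦ [Φ]`, by
  `memLp_two_of_mem_piSchwartzBruhat_of_isAddHaarMeasure`), `coeFn_schwartzBruhatToL2` (`[Φ] =ᵐ Φ`),
  `norm_schwartzBruhatToL2_eq_sqrt` (`‖[Φ]‖ = √(∫⁻ ‖Φ‖ₑ²)`), and `denseRange_schwartzBruhatToL2_of_dense` (the density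
  statement of the GR-1 lane, `Dense {f | ∃ Φ ∈ 𝒮, f =ᵐ Φ}`, IS `DenseRange`);
* §2 **`mem_scaledIsometries_schwartzBruhatToL2_of_lintegral`** — an operator `M` of `𝒮(𝐀_F^ι)` with
  `∫⁻ ‖MΦ‖ₑ² dν = c · ∫⁻ ‖Φ‖ₑ² dν` (`c ≠ 0`, the shape in which "`L²`-isometric up to a positive scalar" is proved
  by `adelicMpCont.induction_on_generators`) is a scaled `[·]`-isometry of scale `√c`;
  `adelicMpCont.toOp_mem_scaledIsometries_toL2_of_lintegral` (all of `Mp_ψ(W_𝐀)ᶜᵒⁿᵗ`);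
* §3 **`schrodingerHaar_rep_schwartzBruhatToL2`** — the `L²` Schrödinger operators `SchrodingerHaar.rep` extend
  Weil's `adelicSchrodinger` along `[·]` (the `[·]`-packaged form of the GR-1 lane's `rep_toLp_eq_toLp_adelicSchrodinger`);
  `continuous_schrodingerHaar_rep` (isometries are continuous);
* §4 **`adelicMpCont.unitaryLegL2 ν hd hall : adelicMpCont F ι T →* MpPsi (SchrodingerHaar.rep … ν)`** — THE LEG ON
  `L²(𝐀_F^ι)`: over the identity of `Sp(W_𝐀)`, unitary operators extending `(scale M)⁻¹ • M`; remaining inputs: density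
  of `𝒮` in `L²` (`hd`) and the scalar identities `hall` (both supplied by the GR lane's analytic files).

## References
* [GelbartRogawski1991] S. Gelbart, J. Rogawski, Invent. Math. 105 (1991) 445–472, §3.1 p. 454 L19–27.
* [Weil1964] A. Weil, Acta Math. 111 (1964) 143–211, Chap. I n° 11–13, Chap. III n° 37.
-/

set_option autoImplicit false

noncomputable section

open NumberField MeasureTheory
open scoped Matrix ENNReal NNReal

namespace Literature.NumberTheory.Weil1964

open Literature.RepresentationTheory.HeisenbergGroup Literature.NumberTheory.Automorphic
open Literature.RepresentationTheory.Unitary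

attribute [local instance] secondCountableTopology_adeleRing

variable (F : Type) [Field F] [NumberField F] (ι : Type) [Fintype ι]
variable [MeasurableSpace (AdeleRing (𝓞 F) F)] [BorelSpace (AdeleRing (𝓞 F) F)]
  (ν : Measure (ι → AdeleRing (𝓞 F) F)) [ν.IsAddHaarMeasure]

/-! ## §1 The class map `𝒮(𝐀_F^ι) → L²(𝐀_F^ι, ν)` -/

/-- **`Φ ↦ [Φ] : 𝒮(𝐀_F^ι) →ₗ[ℂ] L²(𝐀_F^ι, ν)`**, the class of a Schwartz–Bruhat function in `L²` of an additive Haar measure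
(`𝒮 ⊆ ℒ²`: `memLp_two_of_mem_piSchwartzBruhat_of_isAddHaarMeasure`). [cite: Weil1964, Chap. I n° 11;
GelbartRogawski1991, §3.1 p. 454 L19–21] -/
def schwartzBruhatToL2 : piSchwartzBruhat F ι →ₗ[ℂ] Lp ℂ 2 ν where
  toFun Φ := (memLp_two_of_mem_piSchwartzBruhat_of_isAddHaarMeasure ν Φ.2).toLp (Φ : (ι → AdeleRing (𝓞 F) F) → ℂ)
  map_add' Φ Ψ := MemLp.toLp_add (memLp_two_of_mem_piSchwartzBruhat_of_isAddHaarMeasure ν Φ.2)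
    (memLp_two_of_mem_piSchwartzBruhat_of_isAddHaarMeasure ν Ψ.2)
  map_smul' c Φ := MemLp.toLp_const_smul c (memLp_two_of_mem_piSchwartzBruhat_of_isAddHaarMeasure ν Φ.2)

variable {F ι}

/-- unfolding: `schwartzBruhatToL2 Φ = toLp Φ`. [cite: Weil1964, Chap. I n° 11] -/
theorem schwartzBruhatToL2_apply (Φ : piSchwartzBruhat F ι) :
    schwartzBruhatToL2 F ι ν Φ =
      (memLp_two_of_mem_piSchwartzBruhat_of_isAddHaarMeasure ν Φ.2).toLp (Φ : (ι → AdeleRing (𝓞 F) F) → ℂ) := rfl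

/-- **`[Φ] =ᵐ Φ`**. [cite: Weil1964, Chap. I n° 11] -/
theorem coeFn_schwartzBruhatToL2 (Φ : piSchwartzBruhat F ι) :
    ((schwartzBruhatToL2 F ι ν Φ : Lp ℂ 2 ν) : (ι → AdeleRing (𝓞 F) F) → ℂ) =ᵐ[ν]
      (Φ : (ι → AdeleRing (𝓞 F) F) → ℂ) :=
  MemLp.coeFn_toLp (memLp_two_of_mem_piSchwartzBruhat_of_isAddHaarMeasure ν Φ.2)

/-- `‖[Φ]‖ = ‖Φ‖_{ℒ²(ν)}`. [cite: Weil1964, Chap. I n° 11] -/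
theorem norm_schwartzBruhatToL2 (Φ : piSchwartzBruhat F ι) :
    ‖schwartzBruhatToL2 F ι ν Φ‖ = (eLpNorm (Φ : (ι → AdeleRing (𝓞 F) F) → ℂ) 2 ν).toReal :=
  Lp.norm_toLp _ (memLp_two_of_mem_piSchwartzBruhat_of_isAddHaarMeasure ν Φ.2)

omit [Fintype ι] [BorelSpace (AdeleRing (𝓞 F) F)] [ν.IsAddHaarMeasure] in
/-- the `ℒ²` norm as a square root of `∫⁻ ‖·‖ₑ²`. [folklore] -/
private theorem toReal_eLpNorm_two_eq_sqrt (f : (ι → AdeleRing (𝓞 F) F) → ℂ) :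
    (eLpNorm f 2 ν).toReal = Real.sqrt ((∫⁻ x, ‖f x‖ₑ ^ 2 ∂ν).toReal) := by
  have e : ∫⁻ x, ‖f x‖ₑ ^ (2 : ℝ) ∂ν = ∫⁻ x, ‖f x‖ₑ ^ 2 ∂ν := lintegral_congr fun x => ENNReal.rpow_two _
  rw [eLpNorm_eq_lintegral_rpow_enorm_toReal two_ne_zero ENNReal.ofNat_ne_top, ENNReal.toReal_ofNat, e,
    ← ENNReal.toReal_rpow, Real.sqrt_eq_rpow]

/-- **`‖[Φ]‖ = √(∫⁻ ‖Φ‖ₑ² dν)`**. [cite: Weil1964, Chap. I n° 11] -/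
theorem norm_schwartzBruhatToL2_eq_sqrt (Φ : piSchwartzBruhat F ι) :
    ‖schwartzBruhatToL2 F ι ν Φ‖ =
      Real.sqrt ((∫⁻ x, ‖(Φ : (ι → AdeleRing (𝓞 F) F) → ℂ) x‖ₑ ^ 2 ∂ν).toReal) := by
  rw [norm_schwartzBruhatToL2, toReal_eLpNorm_two_eq_sqrt]

/-- the range of `[·]` is the set of classes a.e. equal to a Schwartz–Bruhat function. [cite: Weil1964, Chap. I n° 11] -/
theorem range_schwartzBruhatToL2 :
    Set.range (schwartzBruhatToL2 F ι ν) =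
      {f : Lp ℂ 2 ν | ∃ Φ ∈ piSchwartzBruhat F ι, (f : (ι → AdeleRing (𝓞 F) F) → ℂ) =ᵐ[ν] Φ} := by
  ext f
  constructor
  · rintro ⟨Φ, rfl⟩
    exact ⟨Φ, Φ.2, coeFn_schwartzBruhatToL2 ν Φ⟩
  · rintro ⟨Φ, hΦ, hf⟩
    refine ⟨⟨Φ, hΦ⟩, Lp.ext ?_⟩
    exact (coeFn_schwartzBruhatToL2 ν ⟨Φ, hΦ⟩).trans hf.symm

/-- **density**: the statement "`{f | ∃ Φ ∈ 𝒮(𝐀_F^ι), f =ᵐ Φ}` is dense in `L²(ν)`" (the GR lane's form) is `DenseRange [·]`.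
[cite: Weil1964, Chap. I n° 11] -/
theorem denseRange_schwartzBruhatToL2_of_dense
    (h : Dense {f : Lp ℂ 2 ν | ∃ Φ ∈ piSchwartzBruhat F ι, (f : (ι → AdeleRing (𝓞 F) F) → ℂ) =ᵐ[ν] Φ}) :
    DenseRange (schwartzBruhatToL2 F ι ν) := by
  rw [DenseRange, range_schwartzBruhatToL2]
  exact h

/-- `[·] ≠ 0`: there is a Schwartz–Bruhat function whose class is non-zero, as soon as one has `∫⁻ ‖Φ‖ₑ² ≠ 0`.
[cite: Weil1964, Chap. I n° 11] -/
theorem schwartzBruhatToL2_ne_zero_of_lintegral_ne_zero (Φ : piSchwartzBruhat F ι)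
    (h : ∫⁻ x, ‖(Φ : (ι → AdeleRing (𝓞 F) F) → ℂ) x‖ₑ ^ 2 ∂ν ≠ 0) : schwartzBruhatToL2 F ι ν Φ ≠ 0 := by
  intro h0
  have h1 : ‖schwartzBruhatToL2 F ι ν Φ‖ = 0 := by rw [h0, norm_zero]
  rw [norm_schwartzBruhatToL2_eq_sqrt, Real.sqrt_eq_zero ENNReal.toReal_nonneg,
    ENNReal.toReal_eq_zero_iff] at h1
  rcases h1 with h1 | h1
  · exact h h1
  · exact (lintegral_enorm_sq_lt_top_of_mem_piSchwartzBruhat ν Φ.2).ne h1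

/-! ## §2 Scaled isometries from `∫⁻ ‖MΦ‖ₑ² = c · ∫⁻ ‖Φ‖ₑ²` -/

/-- **an operator of `𝒮(𝐀_F^ι)` with `∫⁻ ‖MΦ‖ₑ² dν = c · ∫⁻ ‖Φ‖ₑ² dν` (`c ≠ 0`) is a scaled `[·]`-isometry** (scale `√c`).
[cite: Weil1964, Chap. I n° 13 p. 160] -/
theorem mem_scaledIsometries_schwartzBruhatToL2_of_lintegral
    (M : piSchwartzBruhat F ι ≃ₗ[ℂ] piSchwartzBruhat F ι) {c : ℝ≥0} (hc : c ≠ 0)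
    (h : ∀ Φ : piSchwartzBruhat F ι,
      ∫⁻ x, ‖((M Φ : piSchwartzBruhat F ι) : (ι → AdeleRing (𝓞 F) F) → ℂ) x‖ₑ ^ 2 ∂ν =
        c * ∫⁻ x, ‖(Φ : (ι → AdeleRing (𝓞 F) F) → ℂ) x‖ₑ ^ 2 ∂ν) :
    M ∈ scaledIsometries (schwartzBruhatToL2 F ι ν) := by
  refine ⟨Real.sqrt c, Real.sqrt_pos.2 (NNReal.coe_pos.2 (pos_iff_ne_zero.2 hc)), fun Φ => ?_⟩
  rw [norm_schwartzBruhatToL2_eq_sqrt, norm_schwartzBruhatToL2_eq_sqrt, h, ENNReal.toReal_mul, ENNReal.coe_toReal,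
    Real.sqrt_mul (NNReal.coe_nonneg c)]

/-- the exact case `∫⁻ ‖MΦ‖ₑ² = ∫⁻ ‖Φ‖ₑ²`: `M` is an exact `[·]`-isometry. [cite: Weil1964, Chap. I n° 13 p. 160] -/
theorem norm_schwartzBruhatToL2_map_eq_of_lintegral (M : piSchwartzBruhat F ι ≃ₗ[ℂ] piSchwartzBruhat F ι)
    (h : ∀ Φ : piSchwartzBruhat F ι,
      ∫⁻ x, ‖((M Φ : piSchwartzBruhat F ι) : (ι → AdeleRing (𝓞 F) F) → ℂ) x‖ₑ ^ 2 ∂ν =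
        ∫⁻ x, ‖(Φ : (ι → AdeleRing (𝓞 F) F) → ℂ) x‖ₑ ^ 2 ∂ν)
    (Φ : piSchwartzBruhat F ι) : ‖schwartzBruhatToL2 F ι ν (M Φ)‖ = ‖schwartzBruhatToL2 F ι ν Φ‖ := by
  rw [norm_schwartzBruhatToL2_eq_sqrt, norm_schwartzBruhatToL2_eq_sqrt, h]

variable [DecidableEq ι] (T : Matrix ι ι (AdeleRing (𝓞 F) F))

/-- **every operator of `Mp_ψ(W_𝐀)ᶜᵒⁿᵗ` is a scaled `[·]`-isometry** as soon as each satisfies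
`∫⁻ ‖ω(p)Φ‖ₑ² dν = c_p · ∫⁻ ‖Φ‖ₑ² dν` with `c_p ≠ 0` — the hypothesis `hall` of `adelicMpCont.unitaryLeg` for `L²(𝐀_F^ι, ν)`.
[cite: Weil1964, Chap. I n° 13 p. 160; GelbartRogawski1991, §3.1 p. 454 L21–27] -/
theorem adelicMpCont.toOp_mem_scaledIsometries_toL2_of_lintegral
    (h : ∀ p : adelicMpCont F ι T, ∃ c : ℝ≥0, c ≠ 0 ∧ ∀ Φ : piSchwartzBruhat F ι,
      ∫⁻ x, ‖((adelicMpCont.toOp F ι T p Φ : piSchwartzBruhat F ι) : (ι → AdeleRing (𝓞 F) F) → ℂ) x‖ₑ ^ 2 ∂ν =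
        c * ∫⁻ x, ‖(Φ : (ι → AdeleRing (𝓞 F) F) → ℂ) x‖ₑ ^ 2 ∂ν)
    (p : adelicMpCont F ι T) : adelicMpCont.toOp F ι T p ∈ scaledIsometries (schwartzBruhatToL2 F ι ν) := by
  obtain ⟨c, hc, hp⟩ := h p
  exact mem_scaledIsometries_schwartzBruhatToL2_of_lintegral ν _ hc hp

/-! ## §3 The `L²` Schrödinger operators extend Weil's operators along `[·]` -/

section Schrodinger

variable (hψc : Continuous (adeleAddChar F : AdeleRing (𝓞 F) F → Circle))
  (hβc : ∀ y : ι → AdeleRing (𝓞 F) F, Continuous fun u : ι → AdeleRing (𝓞 F) F => adelicForm F ι T u y)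

/-- **`ρ_{L²}(h) [Φ] = [ρ(h) Φ]`**: the `L²` Schrödinger operator of `h ∈ H(W_𝐀)` (`SchrodingerHaar.rep`) on the class of a
Schwartz–Bruhat function is the class of Weil's `adelicSchrodinger F ι T h` — the `[·]`-packaged form of the GR-1 lane's
`rep_toLp_eq_toLp_adelicSchrodinger` (both operators are `u ↦ ψ_F(t + ⟨u, T y⟩) Φ(u + x)`).
[cite: Weil1964, Chap. I n° 11, n° 13; MoeglinVignerasWaldspurger1987, Chap. 2 I.4 Exemple (1)] -/
theorem schrodingerHaar_rep_schwartzBruhatToL2 (h : AdelicHeisenberg F ι T) (Φ : piSchwartzBruhat F ι) :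
    SchrodingerHaar.rep (adelicForm F ι T) (adeleAddChar F) hψc hβc ν h (schwartzBruhatToL2 F ι ν Φ) =
      schwartzBruhatToL2 F ι ν (adelicSchrodinger F ι T h Φ) := by
  rw [schwartzBruhatToL2_apply, schwartzBruhatToL2_apply, SchrodingerHaar.rep_toLp]
  refine MemLp.toLp_congr _ _ (Filter.Eventually.of_forall fun u => ?_)
  rw [adelicSchrodinger_apply]
  exact congrArg₂ (· * ·) (congrArg (fun r : AdeleRing (𝓞 F) F => ((adeleAddChar F (h.t + r) : Circle) : ℂ))
    (adelicForm_apply T u h.v.2)) rfl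

/-- the `L²` Schrödinger operators are continuous (they are isometries). [cite: GelbartRogawski1991, §3.1 p. 454 L19–23] -/
theorem continuous_schrodingerHaar_rep (h : AdelicHeisenberg F ι T) :
    Continuous (SchrodingerHaar.rep (adelicForm F ι T) (adeleAddChar F) hψc hβc ν h) :=
  AddMonoidHomClass.continuous_of_bound (SchrodingerHaar.rep (adelicForm F ι T) (adeleAddChar F) hψc hβc ν h) 1
    fun f => by rw [one_mul, SchrodingerHaar.norm_rep_apply]

end Schrodinger

/-! ## §4 The unitary leg on `L²(𝐀_F^ι, ν)` -/

section Leg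

variable (hψc : Continuous (adeleAddChar F : AdeleRing (𝓞 F) F → Circle))
  (hβc : ∀ y : ι → AdeleRing (𝓞 F) F, Continuous fun u : ι → AdeleRing (𝓞 F) F => adelicForm F ι T u y)
  (hd : DenseRange (schwartzBruhatToL2 F ι ν))
  (hall : ∀ p : adelicMpCont F ι T, adelicMpCont.toOp F ι T p ∈ scaledIsometries (schwartzBruhatToL2 F ι ν))

/-- **THE UNITARY LEG ON `L²(𝐀_F^ι)`**: `Mp_ψ(W_𝐀)ᶜᵒⁿᵗ →* MpPsi ρ_{L²}`, `(g, M) ↦ (g, U_M)` with `U_M` the unitary of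
`L²(𝐀_F^ι, ν)` extending `(scale M)⁻¹ • M`, `ρ_{L²} = SchrodingerHaar.rep (adelicForm F ι T) ψ_F … ν` the `L²` completion of
Weil's smooth Schrödinger model — print's `Mp_𝐀(W)` over "the space of `ρ_ψ`" = `L²`.  Inputs: density of `𝒮` in `L²` and
the scalar identities `hall`. [cite: GelbartRogawski1991, §3.1 p. 454 L19–27; Weil1964, Chap. I n° 13 p. 160, Chap. III
n° 37] -/
def adelicMpCont.unitaryLegL2 :
    adelicMpCont F ι T →* MpPsi (SchrodingerHaar.rep (adelicForm F ι T) (adeleAddChar F) hψc hβc ν) :=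
  adelicMpCont.unitaryLeg (schwartzBruhatToL2 F ι ν) hd hall
    (SchrodingerHaar.rep (adelicForm F ι T) (adeleAddChar F) hψc hβc ν)
    (continuous_schrodingerHaar_rep ν T hψc hβc)
    (schrodingerHaar_rep_schwartzBruhatToL2 ν T hψc hβc)

/-- **the `L²` leg lies over the identity of `Sp(W_𝐀)`**. [cite: GelbartRogawski1991, §3.1 p. 454 L25] -/
@[simp] theorem adelicMpCont.proj_unitaryLegL2 (p : adelicMpCont F ι T) :
    MpPsi.proj _ (adelicMpCont.unitaryLegL2 ν T hψc hβc hd hall p) = adelicMpCont.proj F ι T p := rfl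

/-- **`U_M [Φ] = (scale M)⁻¹ • [M Φ]`** on `L²(𝐀_F^ι)`. [cite: Weil1964, Chap. I n° 13 p. 160] -/
theorem adelicMpCont.toOp_unitaryLegL2_apply_toL2 (p : adelicMpCont F ι T) (Φ : piSchwartzBruhat F ι) :
    MpPsi.toOp _ (adelicMpCont.unitaryLegL2 ν T hψc hβc hd hall p) (schwartzBruhatToL2 F ι ν Φ) =
      ((scale (schwartzBruhatToL2 F ι ν) (adelicMpCont.toOp F ι T p) : ℂ)⁻¹) •
        schwartzBruhatToL2 F ι ν (adelicMpCont.toOp F ι T p Φ) :=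
  adelicMpCont.toOp_unitaryLeg_apply_apply (schwartzBruhatToL2 F ι ν) hd hall _
    (continuous_schrodingerHaar_rep ν T hψc hβc) (schrodingerHaar_rep_schwartzBruhatToL2 ν T hψc hβc) p Φ

/-- the operators of the `L²` leg are isometries of `L²(𝐀_F^ι)`. [cite: GelbartRogawski1991, §3.1 p. 454 L24–25] -/
theorem adelicMpCont.norm_toOp_unitaryLegL2 (p : adelicMpCont F ι T) (f : Lp ℂ 2 ν) :
    ‖MpPsi.toOp _ (adelicMpCont.unitaryLegL2 ν T hψc hβc hd hall p) f‖ = ‖f‖ :=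
  adelicMpCont.norm_toOp_unitaryLeg (schwartzBruhatToL2 F ι ν) hd hall _
    (continuous_schrodingerHaar_rep ν T hψc hβc) (schrodingerHaar_rep_schwartzBruhatToL2 ν T hψc hβc) p f

/-- the operators of the `L²` leg and their inverses are continuous (print's "operator", rendering R4).
[cite: GelbartRogawski1991, §3.1 p. 454 L23] -/
theorem adelicMpCont.continuous_toOp_unitaryLegL2 (p : adelicMpCont F ι T) :
    Continuous (MpPsi.toOp _ (adelicMpCont.unitaryLegL2 ν T hψc hβc hd hall p)) ∧
      Continuous (MpPsi.toOp _ (adelicMpCont.unitaryLegL2 ν T hψc hβc hd hall p)).symm :=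
  ⟨adelicMpCont.continuous_toOp_unitaryLeg (schwartzBruhatToL2 F ι ν) hd hall _
      (continuous_schrodingerHaar_rep ν T hψc hβc) (schrodingerHaar_rep_schwartzBruhatToL2 ν T hψc hβc) p,
    adelicMpCont.continuous_toOp_unitaryLeg_symm (schwartzBruhatToL2 F ι ν) hd hall _
      (continuous_schrodingerHaar_rep ν T hψc hβc) (schrodingerHaar_rep_schwartzBruhatToL2 ν T hψc hβc) p⟩

/-- **strong continuity of the `L²` leg along a map** `t : Z → Mp_ψ(W_𝐀)ᶜᵒⁿᵗ`: if every `z ↦ [ω(t z) Φ]` is continuous in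
`L²(𝐀_F^ι)` (e.g. `AdelicMetaplecticL2Continuity.continuous_toL2_omega_comp` along a continuous homomorphism), then every
`z ↦ U_{t z} f`, `f ∈ L²`, is continuous. [cite: GelbartRogawski1991, Prop. 3.1.1 p. 455 L1–2; Weil1964, Chap. III n° 39] -/
theorem adelicMpCont.continuous_toOp_unitaryLegL2_comp_apply {Z : Type*} [TopologicalSpace Z]
    (t : Z → adelicMpCont F ι T)
    (ht : ∀ Φ : piSchwartzBruhat F ι, Continuous fun z => schwartzBruhatToL2 F ι ν (adelicMpCont.toOp F ι T (t z) Φ))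
    (f : Lp ℂ 2 ν) :
    Continuous fun z => MpPsi.toOp _ (adelicMpCont.unitaryLegL2 ν T hψc hβc hd hall (t z)) f :=
  adelicMpCont.continuous_toOp_unitaryLeg_comp_apply (schwartzBruhatToL2 F ι ν) hd hall _
    (continuous_schrodingerHaar_rep ν T hψc hβc) (schrodingerHaar_rep_schwartzBruhatToL2 ν T hψc hβc) t ht f

end Leg

end Literature.NumberTheory.Weil1964

end
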